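import Summits.AnomalousDissipation.AnomalousDissipation.Theorems.ScalarAnomalySteadySourceFormal.Negative.ShearHonest

/-!
# Negative knowledge for the crux `ScalarAnomalySteadySourceFormal` (stmt-AnomalousDissipation-0448), IX:
# the SCALAR of a witness must reach the diffusive scale

Certified copy of §11 of the cdisprove work file.  A cheap but sharp structural fact, dual to the
velocity-side no-gos of §9–§10: if the scalars of a candidate family are band-limited,
`𝓕θ_j(t)(k) = 0` for `|k|² > Λ_j²`, with `ν_j Λ_j² → 0`, then bounded variance excludes a dissipation
floor (`scalarBandLimited_not_anomalous`) — for ANY velocities, data and weak solutions of the class.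
Pointwise `‖∇θ‖² ≤ 4π²Λ² ‖θ‖²` (`eScalarGradNormSq_le_of_bandLimited`) gives
`timeMean (ν‖∇θ‖²) ≤ 4π²νΛ² · timeMean ‖θ‖²`, and the variance means are honest
(`Negative.ShearHonest.honest_variance`: Poincaré + mean conservation + the floor).  Contrapositive:
a witness carries, in time-mean, spectral mass at `|k| ≳ (ε/E)^{1/2} (2π)⁻¹ ν_j^{-1/2}` — the
Batchelor/diffusive scale — uniformly in `j` (quantified in `dissipation_mean_le_of_bandLimited`).

Supports stmt-AnomalousDissipation-0448.
-/

set_option linter.dupNamespace false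

noncomputable section

open scoped BigOperators Topology ENNReal NNReal InnerProductSpace ContDiff
open Filter Set Function MeasureTheory UnitAddTorus Complex

namespace Summit.AnomalousDissipation.AnomalousDissipation.Theorems.ScalarAnomalySteadySourceFormal.Negative

open Literature.Analysis
open Literature.Analysis.FunctionSpaces Literature.Analysis.FunctionSpaces.Torus
open Literature.Analysis.FluidPDE Literature.Analysis.FluidPDE.Torus

variable {d : Type*} [Fintype d]

section BandLimitedScalar

/-- **Bernstein for the spectral gradient**: if `𝓕f(k) = 0` whenever `|k|² > Λ²`, then
`‖∇f‖² ≤ 4π²Λ² ‖f‖²` (for `f ∈ L²`, in `ℝ≥0∞`). [folklore] -/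
theorem eScalarGradNormSq_le_of_bandLimited {f : UnitAddTorus d → ℝ} (hf : MemLp f 2 volume) {Λ : ℝ}
    (hband : ∀ k : d → ℤ, Λ ^ 2 < freqNormSq k → mFourierCoeff (fun x => (f x : ℂ)) k = 0) :
    eScalarGradNormSq f ≤ ENNReal.ofReal (4 * Real.pi ^ 2 * Λ ^ 2 * scalarL2Sq f) := by
  rw [eScalarGradNormSq_eq_tsum]
  have hR : ENNReal.ofReal (4 * Real.pi ^ 2 * Λ ^ 2 * scalarL2Sq f) =
      ENNReal.ofReal (4 * Real.pi ^ 2) * ∑' k : d → ℤ, ENNReal.ofReal (Λ ^ 2) * ‖mFourierCoeff (fun x => (f x : ℂ)) k‖ₑ ^ 2 := by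
    rw [ENNReal.tsum_mul_left, tsum_enorm_sq_mFourierCoeff hf, ← ENNReal.ofReal_mul (by positivity),
      ← ENNReal.ofReal_mul (by positivity), scalarL2Sq]
    ring_nf
  rw [hR]
  refine mul_le_mul_right (ENNReal.tsum_le_tsum fun k => ?_) _
  by_cases hk : Λ ^ 2 < freqNormSq k
  · rw [hband k hk]; simp
  · push Not at hk
    exact mul_le_mul_left (ENNReal.ofReal_le_ofReal hk) _

variable {ν : ℝ} {u : ℝ → UnitAddTorus d → EuclideanSpace ℝ d} {h θ₀ : UnitAddTorus d → ℝ}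
  {θ : ℝ → UnitAddTorus d → ℝ}

/-- **Dissipation means of a band-limited scalar**: for a weak solution of the class whose slices are
band-limited to `|k| ≤ Λ`, `timeMean (ν‖∇θ‖²) T ≤ 4π²νΛ² · timeMean ‖θ‖² T` for every `T > 0`, and
the dissipation integral is finite. [folklore] -/
theorem dissipation_mean_le_of_bandLimited (hw : IsWeakScalarTransportForced ν u (fun _ => h) θ₀ θ) (hν : 0 ≤ ν)
    {Λ : ℝ} (hband : ∀ t, ∀ k : d → ℤ, Λ ^ 2 < freqNormSq k → mFourierCoeff (fun x => (θ t x : ℂ)) k = 0)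
    {T : ℝ} (hT : 0 < T) :
    (∫⁻ t in Ioo 0 T, eScalarGradNormSq (θ t)) ≠ ⊤ ∧
      timeMean (fun t => ν * (eScalarGradNormSq (θ t)).toReal) T ≤
        4 * Real.pi ^ 2 * ν * Λ ^ 2 * timeMean (fun t => scalarL2Sq (θ t)) T := by
  have hwT := hw T hT
  have hGm : AEMeasurable (fun t => eScalarGradNormSq (θ t)) (volume.restrict (Ioo 0 T)) :=
    forced_aemeasurable_eScalarGradNormSq hwT
  have hae : ∀ᵐ t ∂(volume.restrict (Ioo 0 T)),
      eScalarGradNormSq (θ t) ≤ ENNReal.ofReal (4 * Real.pi ^ 2 * Λ ^ 2 * scalarL2Sq (θ t)) := by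
    filter_upwards [forced_ae_memLp_two hwT] with t ht
    exact eScalarGradNormSq_le_of_bandLimited ht (hband t)
  have hVi := forced_integrableOn_scalarL2Sq hwT
  have hlin : ∫⁻ t in Ioo 0 T, eScalarGradNormSq (θ t) ≤
      ENNReal.ofReal (4 * Real.pi ^ 2 * Λ ^ 2 * ∫ t in Ioo 0 T, scalarL2Sq (θ t)) := by
    calc ∫⁻ t in Ioo 0 T, eScalarGradNormSq (θ t)
        ≤ ∫⁻ t in Ioo 0 T, ENNReal.ofReal (4 * Real.pi ^ 2 * Λ ^ 2 * scalarL2Sq (θ t)) := lintegral_mono_ae hae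
      _ = ENNReal.ofReal (∫ t in Ioo 0 T, 4 * Real.pi ^ 2 * Λ ^ 2 * scalarL2Sq (θ t)) := by
          rw [ofReal_integral_eq_lintegral_ofReal (hVi.const_mul _)
            (Eventually.of_forall fun t => by have := scalarL2Sq_nonneg (θ t); positivity)]
      _ = ENNReal.ofReal (4 * Real.pi ^ 2 * Λ ^ 2 * ∫ t in Ioo 0 T, scalarL2Sq (θ t)) := by rw [integral_const_mul]
  have hfin : (∫⁻ t in Ioo 0 T, eScalarGradNormSq (θ t)) ≠ ⊤ := ne_top_of_le_ne_top ENNReal.ofReal_ne_top hlin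
  refine ⟨hfin, ?_⟩
  have hV0 : 0 ≤ ∫ t in Ioo 0 T, scalarL2Sq (θ t) := setIntegral_nonneg measurableSet_Ioo fun _ _ => scalarL2Sq_nonneg _
  have hreal : (∫⁻ t in Ioo 0 T, eScalarGradNormSq (θ t)).toReal ≤ 4 * Real.pi ^ 2 * Λ ^ 2 * ∫ t in Ioo 0 T, scalarL2Sq (θ t) :=
    ENNReal.toReal_le_of_le_ofReal (by positivity) hlin
  rw [timeMean_diss_eq hw hT hfin, timeMean, intervalIntegral.integral_of_le hT.le, integral_Ioc_eq_integral_Ioo]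
  have hTi : 0 < T⁻¹ := inv_pos.2 hT
  calc T⁻¹ * (ν * (∫⁻ t in Ioo 0 T, eScalarGradNormSq (θ t)).toReal)
      ≤ T⁻¹ * (ν * (4 * Real.pi ^ 2 * Λ ^ 2 * ∫ t in Ioo 0 T, scalarL2Sq (θ t))) := by gcongr
    _ = 4 * Real.pi ^ 2 * ν * Λ ^ 2 * (T⁻¹ * ∫ t in Ioo 0 T, scalarL2Sq (θ t)) := by ring

/-- **NO-GO: a witness' scalar must reach the diffusive scale.**  If the scalars of a family of weak
solutions of the crux's class (one smooth mean-zero source, arbitrary velocities and `L²` data) are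
band-limited to `|k| ≤ Λ_j` with `ν_j Λ_j² → 0`, then bounded variance excludes a dissipation floor. [folklore] -/
theorem scalarBandLimited_not_anomalous (hh : IsSmooth h) (hmean : HasZeroMean h)
    {νs : ℕ → ℝ} (hν : ∀ j, 0 < νs j) {us : ℕ → ℝ → UnitAddTorus d → EuclideanSpace ℝ d}
    {θ₀s : ℕ → UnitAddTorus d → ℝ} (hθ₀ : ∀ j, MemLp (θ₀s j) 2 volume) {θs : ℕ → ℝ → UnitAddTorus d → ℝ}
    (hweak : ∀ j, IsWeakScalarTransportForced (νs j) (us j) (fun _ => h) (θ₀s j) (θs j))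
    {Λs : ℕ → ℝ} (hband : ∀ j t, ∀ k : d → ℤ, Λs j ^ 2 < freqNormSq k → mFourierCoeff (fun x => (θs j t x : ℂ)) k = 0)
    (hνΛ : Tendsto (fun j => νs j * Λs j ^ 2) atTop (nhds 0))
    {E : ℝ} (hV : ∀ j, longTimeAvgSup (fun t => scalarL2Sq (θs j t)) ≤ E) :
    ¬ ∃ ε : ℝ, 0 < ε ∧ ∀ j, ε ≤ longTimeAvgSup (fun t => νs j * (eScalarGradNormSq (θs j t)).toReal) := by
  rintro ⟨ε, hε, hfl⟩
  have hhi : Integrable h volume := hh.integrable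
  obtain ⟨E', hE'⟩ : ∃ E' : ℝ, E' = max E 0 + 1 := ⟨_, rfl⟩
  have hE'0 : 0 < E' := by rw [hE']; have := le_max_right E 0; linarith only [this]
  have hEE' : E < E' := by rw [hE']; have := le_max_left E 0; linarith only [this]
  have hπ := Real.pi_pos
  -- choose `j` with `4π² ν_j Λ_j² E' ≤ ε/2`
  have hB : 0 < 4 * Real.pi ^ 2 * E' := by positivity
  obtain ⟨j, hj⟩ := ((tendsto_order.1 hνΛ).2 (ε / 2 / (4 * Real.pi ^ 2 * E')) (by positivity)).exists
  have hcoef : 4 * Real.pi ^ 2 * νs j * Λs j ^ 2 * E' ≤ ε / 2 := by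
    have h1 : νs j * Λs j ^ 2 < ε / 2 / (4 * Real.pi ^ 2 * E') := hj
    rw [lt_div_iff₀ hB] at h1
    nlinarith only [h1]
  have hw := hweak j
  have hfin : ∀ T, 0 < T → ∫⁻ t in Ioo 0 T, eScalarGradNormSq (θs j t) ≠ ⊤ :=
    fun T hT => (dissipation_mean_le_of_bandLimited hw (hν j).le (hband j) hT).1
  have hhon := honest_variance hw (hν j) hhi hmean ((hθ₀ j).integrable one_le_two) hfin hε (hfl j) (hV j) (sub_pos.2 hEE')
  rw [show E + (E' - E) = E' by ring] at hhon
  have hev : ∀ᶠ T in atTop, timeMean (fun t => νs j * (eScalarGradNormSq (θs j t)).toReal) T ≤ ε / 2 := by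
    filter_upwards [hhon, eventually_gt_atTop (0 : ℝ)] with T hVT hT0
    have h1 := (dissipation_mean_le_of_bandLimited hw (hν j).le (hband j) hT0).2
    have h2 : 4 * Real.pi ^ 2 * νs j * Λs j ^ 2 * timeMean (fun t => scalarL2Sq (θs j t)) T ≤
        4 * Real.pi ^ 2 * νs j * Λs j ^ 2 * E' :=
      mul_le_mul_of_nonneg_left hVT (by have := (hν j).le; positivity)
    linarith only [h1, h2, hcoef]
  have hfreq := frequently_le_timeMean_of_le_longTimeAvgSup hε (by positivity : (0 : ℝ) < ε / 4) (hfl j)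
  obtain ⟨T, hT1, hT2⟩ := (hfreq.and_eventually hev).exists
  linarith only [hT1, hT2, hε]

/-- The same through the clause bundle of `Negative.KillShape` (planar): a candidate family of the crux
whose scalars stay band-limited below the diffusive scale (`ν_jΛ_j² → 0`) with bounded variance is
not anomalous. [folklore] -/
theorem not_anomalous_of_isCandidate_scalarBandLimited {g : UnitAddTorus (Fin 2) → EuclideanSpace ℝ (Fin 2)}
    {h : UnitAddTorus (Fin 2) → ℝ} (hadm : IsAdmissible g h) {ν : ℕ → ℝ}
    {v₀ : ℕ → UnitAddTorus (Fin 2) → EuclideanSpace ℝ (Fin 2)} {v : ℕ → ℝ → UnitAddTorus (Fin 2) → EuclideanSpace ℝ (Fin 2)}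
    {θ₀ : ℕ → UnitAddTorus (Fin 2) → ℝ} {θ : ℕ → ℝ → UnitAddTorus (Fin 2) → ℝ}
    (hcand : IsCandidate g h ν v₀ v θ₀ θ) {Λs : ℕ → ℝ}
    (hband : ∀ j t, ∀ k : Fin 2 → ℤ, Λs j ^ 2 < freqNormSq k → mFourierCoeff (fun x => (θ j t x : ℂ)) k = 0)
    (hνΛ : Tendsto (fun j => ν j * Λs j ^ 2) atTop (nhds 0)) (hV : VarianceBounded θ) : ¬ Anomalous ν θ := by
  obtain ⟨E, hE⟩ := hV
  exact scalarBandLimited_not_anomalous hadm.smooth_h hadm.zeroMean_h hcand.pos hcand.memLp hcand.weak hband hνΛ hE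

end BandLimitedScalar

end Summit.AnomalousDissipation.AnomalousDissipation.Theorems.ScalarAnomalySteadySourceFormal.Negative
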